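import Summits.BirchSwinnertonDyer.Rank1Residual.AdditivePotMult.QuadraticBaseChangeDescentReal
import HarnessLib

/-!
# The base-change-and-descend END on S₃ (additive places `2`, `3` away from `p` allowed),
# CONDITIONAL on the unramified-base-change fact A233 instead of Milne's A65
# (row T-MIL-S3, FILE G-1; seat n1011-p01 GEN 7)

HONEST FRAMING (cell `b2b-bsdres`, run/shared/lean/b2b/bsd-rank1-residual/, verbatim in every
file): the goal of the cell is to DELETE the COMBINATION-SHAPED residual classes of the
Birch–Swinnerton-Dyer formula for ALL analytic-rank `≤ 1` elliptic curves over `ℚ` — "full BSD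
formula for every rank `≤ 1` curve in class `C`" assembled STRICTLY from published theorems — so
that the rank-`≤ 1` remainder becomes exactly the CONSTRUCTION-SHAPED classes, which are TYPED
(missing-input `Prop`s), NOT attempted. This is not "finishing BSD". Sub-classes X3♯(M) / X4(M)
(additive, potentially multiplicative prime; base-change-and-descend): a RESEARCH ROUTE; they stay
CONSTRUCTION-SHAPED; nothing is booked by this file; no mark / label moved. THEOREMS ONLY: no
definition, no named fact, no `sorry`.

## What (sequel of rows T-MIL-SHA / T-MIL-R1 / T-MIL-REAL)

The uniform A65-free END `bsdp_of_pPartOver_of_bsdp_twist_quadratic` (FILE F-2) needs `W` on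
S₁ ∪ S₂: away from the primes of `d_K`, `W` is semistable, or additive of residue characteristic
`≥ 5` (when `p ≥ 5`). Curves with ADDITIVE reduction at `2` or `3` (besides the pot-mult prime `p`)
— a large share of every table — are the population S₃ of row T-MIL-ODD's END #4
(`padicValRat_norm_mul_tamagawaProduct_eq_of_unramifiedFact`, FILE C-3h), whose odd Tamagawa
identity is CONDITIONAL on the named fact A233
`Literature.NumberTheory.DiophantineGeometry.kodairaSymbolAt_baseChange_of_ramificationIdx_eq_one`
(Silverman *AEC* VII.5.4 (a) / Tate's algorithm under unramified base change), taken as the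
hypothesis `hA`. This file composes END #4 with the signature-agnostic schema (FILE E-2), the
regulator comparison in total rank `≤ 1` (FILE E-1), the two archimedean identities (tree /
FILE F-1) and the `ord_p` descent (FILE D-2):

* `milneQuotient_ordp_of_unramifiedFact_imaginary` / `…_real` — `hWR_p` on S₃ at `p ≥ 5`, total
  rank `≤ 1`, GIVEN `hA`;
* `bsdp_of_pPartOver_of_bsdp_twist_quadratic_of_unramifiedFact` — **the END on S₃, either
  signature: `BSDp W p ⟸ MissingPPartOverAt W' p ∧ BSDp Wd p` for `[K:ℚ] = 2` with `d_K` odd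
  squarefree, `W.analyticRank + Wd.analyticRank ≤ 1`, `W` good ∨ multiplicative ∨ (`ℓ ∣ d_K` ∧ `Wd`
  multiplicative) ∨ (additive with `ℓ ∤ d_K`) at every place, `p ≥ 5` — hypotheses `hGZK`, `hmod`
  and the A233 instance family `hA` (CONDITIONAL on A233; A65 NOT used).**

HONEST LIMITS: CONDITIONAL on A233 (a named fact, not discharged here — the tree's
`QuadraticBaseChangeTamagawaAdditiveUnramified` proves it only at residue characteristic `≥ 5`);
`p ≥ 5` (END #4's regime; at `p = 3` the additive places of type IV/IV* need row T-MIL-B); `d_K`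
odd squarefree; total analytic rank `≤ 1`; X3♯(M)/X4(M) stay CONSTRUCTION-SHAPED; TOOL/END
theorems; closes no class; moves no mark.

References: J. S. Milne, Invent. Math. 17 (1972) §1 Thm. 1, §2 [Milne1972ArithmeticAV];
J. H. Silverman, *AEC* 2nd ed., Prop. VII.5.4 (a) [SilvermanAEC2009]; T. Dokchitser,
V. Dokchitser, Ann. of Math. 172 (2010) §2.1 [DokchitserDokchitserAnnals2010]; R. L. Miller, LMS
J. Comput. Math. 14 (2011) Def. 1.1 [Miller2011LMS].
-/

noncomputable section

open scoped Classical NumberField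

open WeierstrassCurve NumberField NumberField.InfinitePlace IsDedekindDomain Rat.HeightOneSpectrum
  Literature.NumberTheory.EllipticCurves Literature.NumberTheory.EllipticCurves.Rank1Residual
  Literature.NumberTheory.EllipticCurves.Rank1Residual.Typed
  Literature.NumberTheory.DiophantineGeometry

namespace Summit.BirchSwinnertonDyer.Rank1Residual.AdditivePotMult

section UnramifiedFact

variable (W : WeierstrassCurve ℚ) [W.IsElliptic] [W.IsGloballyMinimal] (p : ℕ) [hp : Fact p.Prime]
  (K : Type) [Field K] [NumberField K]
  (Wd : WeierstrassCurve ℚ) [Wd.IsElliptic] [Wd.IsGloballyMinimal]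
  (W' : WeierstrassCurve K) [W'.IsElliptic] [W'.IsGloballyMinimal]

/-- **`hWR_p` on S₃ at `p ≥ 5`, IMAGINARY `K`, total rank `≤ 1`, CONDITIONAL on A233 (`hA`)**:
FILE E-2's schema with `n = n_W` (tree `realPeriod_mul_realPeriod_quadraticTwist_eq_mul_bsdPeriod`),
`m ∈ {1,2,4}` (FILE E-1) and END #4 (`padicValRat_norm_mul_tamagawaProduct_eq_of_unramifiedFact`).
[cite: Milne1972ArithmeticAV, §1 Thm. 1 and §2 (through DokchitserDokchitserAnnals2010, §2.1, proof of Thm. 8)]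
[cite: SilvermanAEC2009, Prop. VII.5.4 (a)] -/
theorem milneQuotient_ordp_of_unramifiedFact_imaginary [IsTotallyComplex K]
    (h2 : Module.finrank ℚ K = 2)
    (hdodd : Odd (NumberField.discr K)) (hdsq : Squarefree (NumberField.discr K))
    {Cd : VariableChange ℚ} (hWd : Cd • W.quadraticTwist (NumberField.discr K : ℚ) = Wd)
    {C' : VariableChange K} (hW' : C' • W.baseChange K = W') [Finite W.sha] [Finite Wd.sha]
    (hr : W.mordellWeilRank + Wd.mordellWeilRank ≤ 1)
    (hA : ∀ (v : HeightOneSpectrum (𝓞 ℚ)) (w : HeightOneSpectrum (𝓞 K)),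
      kodairaSymbolAt_baseChange_of_ramificationIdx_eq_one K v w W)
    (hS : ∀ v : HeightOneSpectrum (𝓞 ℚ), W.HasGoodReductionAt v ∨ W.HasMultiplicativeReductionAt v ∨
      (((primesEquiv v : ℕ) : ℤ) ∣ NumberField.discr K ∧ Wd.HasMultiplicativeReductionAt v) ∨
      (W.HasAdditiveReductionAt v ∧ ¬ ((primesEquiv v : ℕ) : ℤ) ∣ NumberField.discr K))
    (hp5 : 5 ≤ p) :
    ∃ q : ℚ, 0 < q ∧ padicValRat p q = 0 ∧
      (W'.shaOrder : ℝ) * W'.regulator * W'.bsdPeriod * (W'.tamagawaProduct : ℝ) /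
          (W'.torsionOrder : ℝ) ^ 2 = (q : ℝ) * (W.bsdRHS * Wd.bsdRHS) := by
  have hp2 : p ≠ 2 := by omega
  obtain ⟨m, hm124, hm⟩ := exists_mul_regulator_baseChange_quadratic_of_rank_add_le_one W K h2 Wd
    ⟨Cd, hWd⟩ W' ⟨C', hW'⟩ hr
  have hm0 : m ≠ 0 := by rcases hm124 with rfl | rfl | rfl <;> norm_num
  have hn0 : (W.baseChange ℝ).numRealComponents ≠ 0 := (W.baseChange ℝ).numRealComponents_pos.ne'
  haveI : Fact (Nat.Prime 2) := ⟨Nat.prime_two⟩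
  have h2v : padicValRat p (2 : ℚ) = 0 := by
    rw [show (2 : ℚ) = ((2 : ℕ) : ℚ) by norm_num, padicValRat.of_nat, padicValNat_primes hp2,
      Nat.cast_zero]
  have hnv : padicValRat p ((W.baseChange ℝ).numRealComponents : ℚ) = 0 := by
    rw [numRealComponents_baseChange_real]
    split_ifs
    · rw [padicValRat.of_nat, padicValNat_primes hp2, Nat.cast_zero]
    · rw [Nat.cast_one, padicValRat.one]
  have hmv : padicValRat p (m : ℚ) = 0 := by
    rcases hm124 with rfl | rfl | rfl
    · rw [Nat.cast_one, padicValRat.one]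
    · exact_mod_cast h2v
    · rw [show ((4 : ℕ) : ℚ) = (2 : ℚ) ^ 2 by norm_num, padicValRat.pow, h2v, mul_zero]
  exact milneQuotient_ordp_of_tamagawa_of_arch_of_regulator W K Wd W' h2 hWd hW' hn0 hm0
    (realPeriod_mul_realPeriod_quadraticTwist_eq_mul_bsdPeriod W K h2) hm p hp2 hnv hmv
    (padicValRat_norm_mul_tamagawaProduct_eq_of_unramifiedFact W K Wd W' h2 hdodd hdsq hWd hW' hA
      hS p hp5)

/-- **`hWR_p` on S₃ at `p ≥ 5`, REAL `K` (`hreal`), total rank `≤ 1`, CONDITIONAL on A233 (`hA`)**: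
as above with `n = 1` (FILE F-1). [cite: Milne1972ArithmeticAV, §1 Thm. 1 and §2 (through DokchitserDokchitserAnnals2010, §2.1, proof of Thm. 8)]
[cite: SilvermanAEC2009, Prop. VII.5.4 (a)] -/
theorem milneQuotient_ordp_of_unramifiedFact_real (h2 : Module.finrank ℚ K = 2)
    (hreal : IsTotallyReal K)
    (hdodd : Odd (NumberField.discr K)) (hdsq : Squarefree (NumberField.discr K))
    {Cd : VariableChange ℚ} (hWd : Cd • W.quadraticTwist (NumberField.discr K : ℚ) = Wd)
    {C' : VariableChange K} (hW' : C' • W.baseChange K = W') [Finite W.sha] [Finite Wd.sha]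
    (hr : W.mordellWeilRank + Wd.mordellWeilRank ≤ 1)
    (hA : ∀ (v : HeightOneSpectrum (𝓞 ℚ)) (w : HeightOneSpectrum (𝓞 K)),
      kodairaSymbolAt_baseChange_of_ramificationIdx_eq_one K v w W)
    (hS : ∀ v : HeightOneSpectrum (𝓞 ℚ), W.HasGoodReductionAt v ∨ W.HasMultiplicativeReductionAt v ∨
      (((primesEquiv v : ℕ) : ℤ) ∣ NumberField.discr K ∧ Wd.HasMultiplicativeReductionAt v) ∨
      (W.HasAdditiveReductionAt v ∧ ¬ ((primesEquiv v : ℕ) : ℤ) ∣ NumberField.discr K))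
    (hp5 : 5 ≤ p) :
    ∃ q : ℚ, 0 < q ∧ padicValRat p q = 0 ∧
      (W'.shaOrder : ℝ) * W'.regulator * W'.bsdPeriod * (W'.tamagawaProduct : ℝ) /
          (W'.torsionOrder : ℝ) ^ 2 = (q : ℝ) * (W.bsdRHS * Wd.bsdRHS) :=
  milneQuotient_ordp_of_tamagawa_real W p K Wd W' h2 hreal hWd hW' hr (by omega)
    (padicValRat_norm_mul_tamagawaProduct_eq_of_unramifiedFact W K Wd W' h2 hdodd hdsq hWd hW' hA
      hS p hp5)

/-- **THE BASE-CHANGE-AND-DESCEND END ON S₃, EITHER SIGNATURE, CONDITIONAL ON A233 (not on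
A65).** `W/ℚ`, `Wd = C_d • W^{(d_K)}`, `W' = C' • W_K` globally minimal; `[K:ℚ] = 2` with `d_K`
odd squarefree; `r_an(W) + r_an(Wd) ≤ 1`; at every place `W` is good ∨ multiplicative ∨
(`ℓ ∣ d_K` ∧ `Wd` multiplicative) ∨ (ADDITIVE with `ℓ ∤ d_K` — residue characteristics `2`, `3`
included); `p ≥ 5`; `hA` = the named fact A233 `kodairaSymbolAt_baseChange_of_ramificationIdx_eq_one`
at every `(v, w)`. THEN **`BSDp W p ⟸ MissingPPartOverAt W' p ∧ BSDp Wd p`** (other hypotheses: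
`hGZK`, `hmod`). So on S₃ the descent trades Milne's A65 for A233 (Silverman *AEC* VII.5.4 (a)).
[cite: Milne1972ArithmeticAV, §1 Thm. 1 and §2 (through DokchitserDokchitserAnnals2010, §2.1, proof of Thm. 8)]
[cite: SilvermanAEC2009, Prop. VII.5.4 (a)] [cite: Miller2011LMS, Def. 1.1 (arXiv:1010.2431 p. 3)] -/
theorem bsdp_of_pPartOver_of_bsdp_twist_quadratic_of_unramifiedFact
    (hGZK : rank_eq_analyticRank_of_analyticRank_le_one) (hmod : hasEntireLFunction_rat)
    (h2 : Module.finrank ℚ K = 2)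
    (hdodd : Odd (NumberField.discr K)) (hdsq : Squarefree (NumberField.discr K))
    {Cd : VariableChange ℚ} (hWd : Cd • W.quadraticTwist (NumberField.discr K : ℚ) = Wd)
    {C' : VariableChange K} (hW' : C' • W.baseChange K = W')
    (hr : W.analyticRank + Wd.analyticRank ≤ 1)
    (hA : ∀ (v : HeightOneSpectrum (𝓞 ℚ)) (w : HeightOneSpectrum (𝓞 K)),
      kodairaSymbolAt_baseChange_of_ramificationIdx_eq_one K v w W)
    (hS : ∀ v : HeightOneSpectrum (𝓞 ℚ), W.HasGoodReductionAt v ∨ W.HasMultiplicativeReductionAt v ∨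
      (((primesEquiv v : ℕ) : ℤ) ∣ NumberField.discr K ∧ Wd.HasMultiplicativeReductionAt v) ∨
      (W.HasAdditiveReductionAt v ∧ ¬ ((primesEquiv v : ℕ) : ℤ) ∣ NumberField.discr K))
    (hp5 : 5 ≤ p) (hK : MissingPPartOverAt W' p) (hd : BSDp Wd p) : BSDp W p := by
  have hr1 : W.analyticRank ≤ 1 := by omega
  have hrd1 : Wd.analyticRank ≤ 1 := by omega
  obtain ⟨hrankW, hfinW⟩ := hGZK W hr1
  obtain ⟨hrankD, hfinD⟩ := hGZK Wd hrd1
  haveI : Finite W.sha := hfinW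
  haveI : Finite Wd.sha := hfinD
  have hrMW : W.mordellWeilRank + Wd.mordellWeilRank ≤ 1 := by rw [hrankW, hrankD]; exact hr
  rcases isTotallyReal_or_isTotallyComplex_of_finrank_eq_two K h2 with hR | hC
  · exact bsdp_of_pPartOver_of_bsdp_twist_ordp W p K Wd W' hGZK hmod hr1 h2 ⟨Cd, hWd⟩ hrd1 ⟨C', hW'⟩
      (milneQuotient_ordp_of_unramifiedFact_real W p K Wd W' h2 hR hdodd hdsq hWd hW' hrMW hA hS hp5)
      hK hd
  · haveI := hC
    exact bsdp_of_pPartOver_of_bsdp_twist_ordp W p K Wd W' hGZK hmod hr1 h2 ⟨Cd, hWd⟩ hrd1 ⟨C', hW'⟩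
      (milneQuotient_ordp_of_unramifiedFact_imaginary W p K Wd W' h2 hdodd hdsq hWd hW' hrMW hA hS
        hp5) hK hd

end UnramifiedFact

end Summit.BirchSwinnertonDyer.Rank1Residual.AdditivePotMult

end
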